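import Mathlib.Analysis.Asymptotics.Defs
import Mathlib.Analysis.SpecialFunctions.Log.Basic
import Literature.Computability.Cryptography.ClassBQP
import Literature.Computability.Cryptography.ClassBQPRelProofs
import HarnessLib

/-!
# `BQP^{A[log]}`: relativised `BQP` with `O(log n)` oracle queries (Aaronson–Ambainis 2014, §3)

Topic `Literature/Computability/QuantumComplexity`; definition item `defn-BQPRelLog`, wanted by
route `QuantumAdvantage/RandomOracleGauge` (item `LogQueryTransfer`, the analogue of
Aaronson–Ambainis' Theorem 26).

S. Aaronson, A. Ambainis, *The need for structure in quantum speedups*, Theory of Computing 10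
(2014) 133–166 = arXiv:0911.0996v3 [AaronsonAmbainis2014], §3, the paragraph before Theorem 26
(arXiv v3 numbering): "Given an oracle `A`, let `BQP^{A[log]}` be the class of languages
decidable by a `BQP` machine able to make `O(log n)` queries to `A`." (It is the hypothesis class
of their unconditional Theorem 26: "Suppose `P = P^{#P}`. Then `BQP^{A[log]} ⊂ AvgP^A_{||}` with
probability `1` for a random oracle `A`.")

## What this file adds

* `BQPRelQueries A t` — the languages decided with error `≤ 1/3` by a poly-time uniform family of
  Clifford+T oracle circuits (oracle gates = XOR queries to the language `A`, exactly the machine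
  model of the tree's `Literature.Computability.Cryptography.BQPRel`) whose `n`-th circuit contains
  at most `t n` oracle gates (`QCircuit.oracleQueries`, the number of `QGate.oracle` gates);
* `BQPRelLog A = BQP^{A[log]} := ⋃ c, BQPRelQueries A (fun n => c * Nat.log 2 n + c)` — at most
  `c·⌊log₂ n⌋ + c` oracle gates on inputs of length `n`, for some constant `c`;
* API: the unfolding lemmas `mem_BQPRelQueries_iff`, `mem_BQPRelLog_iff`; monotonicity in the
  query budget; the sandwich `BQP ⊆ BQPRelQueries A t ⊆ BQPRel A` and
  `BQP ⊆ BQPRelLog A ⊆ BQPRel A` (`BQP_subset_BQPRelLog`, `BQPRelLog_subset_BQPRel`); zero queries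
  and the empty oracle give back `BQP` (`BQPRelQueries_zero`, `BQPRelLog_zero`); and the
  faithfulness lemma `exists_le_mul_log_add_iff_isBigO_log` showing that the budget
  "`≤ c·⌊log₂ n⌋ + c` for all `n`, some `c : ℕ`" is *equivalent* to "`O(log n)`" in Mathlib's
  sense (`=O[atTop] Real.log`), whence `mem_BQPRelLog_iff_isBigO`;
* two bricks on the circuit syntax, deliberate dot-notation extensions of
  `Literature.Computability.Cryptography.QCircuit` / `QCircuitFamily` (other directory):
  `QCircuit.oracleQueries_eq_zero_iff` (no oracle gates iff oracle-free) and
  `QCircuitFamily.acceptProbOn_eq_of_isOracleFree`.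

## Design choices

* "`BQP` machine" = the tree's model of `BQPRel`: a `QCircuitFamily cliffordT` with
  `IsUniform` (poly-time uniform, hence polynomial size) and acceptance thresholds `2/3`, `1/3`
  (`acceptProbOn A`). "Number of queries on inputs of length `n`" = the number of oracle gates of
  the `n`-th circuit (each oracle gate is one query, of any width, possibly in superposition), as
  in the query-complexity files of this directory (`HybridArgument`, `OraclePolynomialMethod`:
  `acceptProbOn` is a polynomial of degree `≤ 2·oracleQueries` in the oracle bits).
* `O(log n)` is rendered by the explicit budget `c * Nat.log 2 n + c` quantified over one
  constant `c : ℕ` and *all* `n` (the additive `c` absorbs the finitely many small `n` and the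
  values `Nat.log 2 0 = Nat.log 2 1 = 0`); `exists_le_mul_log_add_iff_isBigO_log` proves this is
  exactly `O(log n)`.
* Error `1/3` as in `BQPRel`. (Majority vote over a *constant* number of repetitions keeps the
  query budget `O(log n)`, so any constant error in `(0, 1/2)` gives the same class; this
  robustness statement is not needed by the requester and is not proved here.)
* Aaronson–Ambainis' `AvgP^A_{||}` (nonadaptive classical queries) is NOT defined here; the route
  uses the tree's `Literature.Barriers.QuantumAdvantage.AvgPRel`.

## References

* [AaronsonAmbainis2014] S. Aaronson, A. Ambainis, *The need for structure in quantum speedups*,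
  Theory Comput. 10 (2014) 133–166; arXiv:0911.0996v3, §3 (definition of `BQP^{A[log]}` and
  `AvgP^A_{||}`, Thm. 26). Read via `lit read arxiv:0911.0996` (chunk 15).
* [BernsteinVazirani1997] E. Bernstein, U. Vazirani, *Quantum complexity theory*, SIAM J. Comput.
  26 (1997), §8 (oracle quantum machines, `BQP^A`).
-/

noncomputable section

namespace Literature.Computability.QuantumComplexity

open _root_.Computability Filter Asymptotics Complexity Cryptography

/-! ### Two bricks on oracle gates -/

/-- A circuit has no oracle gates (`oracleQueries = 0`) iff it is oracle-free. Deliberate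
dot-notation extension of `Literature.Computability.Cryptography.QCircuit`. [folklore] -/
theorem _root_.Literature.Computability.Cryptography.QCircuit.oracleQueries_eq_zero_iff
    {G : QGateSet} {N : ℕ} (C : QCircuit G N) : C.oracleQueries = 0 ↔ C.IsOracleFree := by
  simp [QCircuit.oracleQueries, QCircuit.IsOracleFree, List.filter_eq_nil_iff]

/-- The acceptance probabilities of an oracle-free family do not depend on the oracle
(`QCircuit.toMatrix_eq_of_isOracleFree`). Deliberate dot-notation extension of
`Literature.Computability.Cryptography.QCircuitFamily`. [cite: BernsteinVazirani1997, §8] -/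
theorem _root_.Literature.Computability.Cryptography.QCircuitFamily.acceptProbOn_eq_of_isOracleFree
    {G : QGateSet} {F : QCircuitFamily G} (hF : F.IsOracleFree) (A B : Language Bool)
    (x : List Bool) : F.acceptProbOn A x = F.acceptProbOn B x := by
  simp only [QCircuitFamily.acceptProbOn, QCircuit.acceptProb, QCircuit.runOn,
    QCircuit.toMatrix_eq_of_isOracleFree (hF x.length) A B]

/-! ### Relativised `BQP` with a query budget -/

/-- `BQPRelQueries A t`: the languages `L ⊆ {0,1}*` decided with two-sided error `≤ 1/3` by a
poly-time uniform family `F` of Clifford+T circuits with oracle gates (XOR queries to the language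
`A`, semantics `acceptProbOn A`, exactly as in `BQPRel A = BQP^A`) whose circuit for inputs of
length `n` contains at most `t n` oracle gates (`(F.circ n).oracleQueries ≤ t n`): a `BQP^A`
machine making at most `t(n)` queries. [cite: AaronsonAmbainis2014, §3 (paragraph before Thm. 26, arXiv v3 numbering)] -/
def BQPRelQueries (A : Language Bool) (t : ℕ → ℕ) : Set (Language Bool) :=
  {L | ∃ F : QCircuitFamily cliffordT, F.IsUniform ∧ (∀ n, (F.circ n).oracleQueries ≤ t n) ∧
    ∀ x, (x ∈ L → 2 / 3 ≤ F.acceptProbOn A x) ∧ (x ∉ L → F.acceptProbOn A x ≤ 1 / 3)}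

/-- **`BQPRelLog A = BQP^{A[log]}`** (Aaronson–Ambainis): "the class of languages decidable by a
`BQP` machine able to make `O(log n)` queries to `A`" — languages decided with error `≤ 1/3` by a
poly-time uniform family of Clifford+T oracle circuits (oracle = XOR query to `A`) whose circuit
for inputs of length `n` contains at most `c·⌊log₂ n⌋ + c` oracle gates, for some constant
`c : ℕ` (this budget is equivalent to `O(log n)`, `exists_le_mul_log_add_iff_isBigO_log`). [cite: AaronsonAmbainis2014, §3 (paragraph before Thm. 26, arXiv v3 numbering)] -/
def BQPRelLog (A : Language Bool) : Set (Language Bool) :=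
  ⋃ c : ℕ, BQPRelQueries A fun n => c * Nat.log 2 n + c

/-! ### API -/

variable {A : Language Bool}

/-- Unfolding lemma for `BQPRelQueries`. [cite: AaronsonAmbainis2014, §3 (paragraph before Thm. 26, arXiv v3 numbering)] -/
theorem mem_BQPRelQueries_iff {t : ℕ → ℕ} {L : Language Bool} :
    L ∈ BQPRelQueries A t ↔ ∃ F : QCircuitFamily cliffordT, F.IsUniform ∧
      (∀ n, (F.circ n).oracleQueries ≤ t n) ∧
      ∀ x, (x ∈ L → 2 / 3 ≤ F.acceptProbOn A x) ∧ (x ∉ L → F.acceptProbOn A x ≤ 1 / 3) :=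
  Iff.rfl

/-- Unfolding lemma for `BQPRelLog`: `L ∈ BQP^{A[log]}` iff some poly-time uniform Clifford+T
oracle-circuit family with at most `c·⌊log₂ n⌋ + c` oracle gates at length `n` decides `L`
relative to `A` with error `≤ 1/3`. [cite: AaronsonAmbainis2014, §3 (paragraph before Thm. 26, arXiv v3 numbering)] -/
theorem mem_BQPRelLog_iff {L : Language Bool} :
    L ∈ BQPRelLog A ↔ ∃ (c : ℕ) (F : QCircuitFamily cliffordT), F.IsUniform ∧
      (∀ n, (F.circ n).oracleQueries ≤ c * Nat.log 2 n + c) ∧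
      ∀ x, (x ∈ L → 2 / 3 ≤ F.acceptProbOn A x) ∧ (x ∉ L → F.acceptProbOn A x ≤ 1 / 3) := by
  simp only [BQPRelLog, Set.mem_iUnion, mem_BQPRelQueries_iff]

/-- `BQPRelLog A` is the union over the constants `c` of the budgeted classes
`BQPRelQueries A (c·⌊log₂ ·⌋ + c)` (definitional). [cite: AaronsonAmbainis2014, §3 (paragraph before Thm. 26, arXiv v3 numbering)] -/
theorem BQPRelLog_eq_iUnion (A : Language Bool) :
    BQPRelLog A = ⋃ c : ℕ, BQPRelQueries A fun n => c * Nat.log 2 n + c :=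
  rfl

/-- Each budgeted class `BQPRelQueries A (c·⌊log₂ ·⌋ + c)` is contained in `BQPRelLog A`. [cite: AaronsonAmbainis2014, §3 (paragraph before Thm. 26, arXiv v3 numbering)] -/
theorem BQPRelQueries_subset_BQPRelLog (A : Language Bool) (c : ℕ) :
    BQPRelQueries A (fun n => c * Nat.log 2 n + c) ⊆ BQPRelLog A :=
  Set.subset_iUnion (fun c : ℕ => BQPRelQueries A fun n => c * Nat.log 2 n + c) c

/-- `BQPRelQueries A` is monotone in the query budget. [folklore] -/
theorem BQPRelQueries_mono {t t' : ℕ → ℕ} (h : t ≤ t') : BQPRelQueries A t ⊆ BQPRelQueries A t' := by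
  rintro L ⟨F, hU, hq, hL⟩
  exact ⟨F, hU, fun n => (hq n).trans (h n), hL⟩

/-- Forgetting the query budget: `BQPRelQueries A t ⊆ BQP^A`. [cite: AaronsonAmbainis2014, §3 (paragraph before Thm. 26, arXiv v3 numbering)] -/
theorem BQPRelQueries_subset_BQPRel (A : Language Bool) (t : ℕ → ℕ) :
    BQPRelQueries A t ⊆ BQPRel A := by
  rintro L ⟨F, hU, -, hL⟩
  exact ⟨F, hU, hL⟩

/-- **`BQP^{A[log]} ⊆ BQP^A`** (forget the query budget). [cite: AaronsonAmbainis2014, §3 (paragraph before Thm. 26, arXiv v3 numbering)] -/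
theorem BQPRelLog_subset_BQPRel (A : Language Bool) : BQPRelLog A ⊆ BQPRel A :=
  Set.iUnion_subset fun _ => BQPRelQueries_subset_BQPRel A _

/-- **`BQP ⊆ BQPRelQueries A t`** for every oracle and every budget (even `t = 0`): an
oracle-free uniform family has no oracle gates and its acceptance probabilities do not depend on
the oracle. [cite: BernsteinVazirani1997, §8] -/
theorem BQP_subset_BQPRelQueries (A : Language Bool) (t : ℕ → ℕ) : BQP ⊆ BQPRelQueries A t := by
  rintro L hL
  obtain ⟨F, hF, hU, h⟩ := ClassBQP.mem_BQP_iff.1 hL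
  refine ⟨F, hU, fun n => ?_, fun x => ?_⟩
  · rw [(QCircuit.oracleQueries_eq_zero_iff _).2 (hF n)]
    exact Nat.zero_le _
  · rw [QCircuitFamily.acceptProbOn_eq_of_isOracleFree hF A 0]
    exact h x

/-- **`BQP ⊆ BQP^{A[log]}`** for every oracle `A`. [cite: AaronsonAmbainis2014, §3 (paragraph before Thm. 26, arXiv v3 numbering)] -/
theorem BQP_subset_BQPRelLog (A : Language Bool) : BQP ⊆ BQPRelLog A :=
  (BQP_subset_BQPRelQueries A _).trans (BQPRelQueries_subset_BQPRelLog A 0)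

/-- With budget `0` the class is `BQP`, whatever the oracle: a uniform family without oracle gates
is an oracle-free uniform family. [cite: BernsteinVazirani1997, §8] -/
theorem BQPRelQueries_zero (A : Language Bool) : BQPRelQueries A 0 = BQP := by
  refine Set.Subset.antisymm ?_ (BQP_subset_BQPRelQueries A 0)
  rintro L ⟨F, hU, hq, hL⟩
  have hF : F.IsOracleFree := fun n =>
    (QCircuit.oracleQueries_eq_zero_iff _).1 (Nat.le_zero.1 (hq n))
  refine ClassBQP.mem_BQP_iff.2 ⟨F, hF, hU, fun x => ?_⟩
  rw [QCircuitFamily.acceptProbOn_eq_of_isOracleFree hF 0 A]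
  exact hL x

/-- Relative to the empty oracle, `BQP^{∅[log]} = BQP` (from the tree's `BQPRel 0 ⊆ BQP`,
`BQPRel_zero_subset_BQP`: oracle gates of the empty oracle are identities and are deleted
uniformly). [cite: BernsteinVazirani1997, §8] -/
theorem BQPRelLog_zero : BQPRelLog 0 = BQP :=
  Set.Subset.antisymm ((BQPRelLog_subset_BQPRel 0).trans BQPRel_zero_subset_BQP)
    (BQP_subset_BQPRelLog 0)

/-! ### The budget `c·⌊log₂ n⌋ + c` is exactly `O(log n)` -/

/-- `⌊log₂ n⌋ · log 2 ≤ log n` (from `2 ^ ⌊log₂ n⌋ ≤ n`; trivial for `n = 0`). [folklore] -/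
theorem natLog_two_mul_log_two_le_log (n : ℕ) : (Nat.log 2 n : ℝ) * Real.log 2 ≤ Real.log n := by
  rcases Nat.eq_zero_or_pos n with rfl | hn
  · simp
  · have h : (2 : ℝ) ^ Nat.log 2 n ≤ n := by exact_mod_cast Nat.pow_log_le_self 2 hn.ne'
    calc (Nat.log 2 n : ℝ) * Real.log 2 = Real.log ((2 : ℝ) ^ Nat.log 2 n) := by
          rw [Real.log_pow]
      _ ≤ Real.log n := Real.log_le_log (by positivity) h

/-- `log n < (⌊log₂ n⌋ + 1) · log 2` (from `n < 2 ^ (⌊log₂ n⌋ + 1)`). [folklore] -/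
theorem log_lt_natLog_two_add_one_mul_log_two (n : ℕ) :
    Real.log n < ((Nat.log 2 n : ℝ) + 1) * Real.log 2 := by
  rcases Nat.eq_zero_or_pos n with rfl | hn
  · simp [Real.log_pos one_lt_two]
  · have h : (n : ℝ) < (2 : ℝ) ^ (Nat.log 2 n + 1) := by
      exact_mod_cast Nat.lt_pow_succ_log_self one_lt_two n
    calc Real.log n < Real.log ((2 : ℝ) ^ (Nat.log 2 n + 1)) :=
          Real.log_lt_log (by exact_mod_cast hn) h
      _ = ((Nat.log 2 n : ℝ) + 1) * Real.log 2 := by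
          rw [Real.log_pow]; push_cast; ring

/-- **Faithfulness of the query budget.** For `t : ℕ → ℕ`, "`t n ≤ c·⌊log₂ n⌋ + c` for all `n`,
for some constant `c : ℕ`" is equivalent to `t = O(log n)` (Mathlib: `(t ·) =O[atTop] log`):
`⇒` with the constant `2c / log 2` on `n ≥ 2`; `⇐` with `c = ⌈C·log 2⌉ + Σ_{n<n₀} t n`, where
`‖t n‖ ≤ C‖log n‖` for `n ≥ n₀`. [folklore] -/
theorem exists_le_mul_log_add_iff_isBigO_log (t : ℕ → ℕ) :
    (∃ c : ℕ, ∀ n, t n ≤ c * Nat.log 2 n + c) ↔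
      (fun n => (t n : ℝ)) =O[atTop] fun n => Real.log (n : ℝ) := by
  have hlog2 : 0 < Real.log 2 := Real.log_pos one_lt_two
  constructor
  · rintro ⟨c, hc⟩
    refine IsBigO.of_bound (2 * c / Real.log 2) (Filter.eventually_atTop.2 ⟨2, fun n hn => ?_⟩)
    rw [Real.norm_natCast, Real.norm_eq_abs, abs_of_nonneg (Real.log_natCast_nonneg n)]
    have hk1 : (1 : ℝ) ≤ Nat.log 2 n := by exact_mod_cast Nat.log_pos one_lt_two hn
    have hk2 := natLog_two_mul_log_two_le_log n
    have ht : (t n : ℝ) ≤ c * Nat.log 2 n + c := by exact_mod_cast hc n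
    have hc0 : (0 : ℝ) ≤ c := Nat.cast_nonneg c
    calc (t n : ℝ) ≤ c * Nat.log 2 n + c := ht
      _ ≤ 2 * c * Nat.log 2 n := by nlinarith
      _ = 2 * c / Real.log 2 * ((Nat.log 2 n : ℝ) * Real.log 2) := by
          field_simp
      _ ≤ 2 * c / Real.log 2 * Real.log n := by gcongr
  · intro h
    obtain ⟨C, hC0, hC⟩ := h.exists_pos
    obtain ⟨n₀, hn₀⟩ := Filter.eventually_atTop.1 hC.bound
    refine ⟨⌈C * Real.log 2⌉₊ + ∑ i ∈ Finset.range n₀, t i, fun n => ?_⟩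
    set c₁ : ℕ := ⌈C * Real.log 2⌉₊ with hc₁
    set M : ℕ := ∑ i ∈ Finset.range n₀, t i with hM
    rcases lt_or_ge n n₀ with hn | hn
    · have h1 : t n ≤ M :=
        Finset.single_le_sum (fun i _ => Nat.zero_le (t i)) (Finset.mem_range.2 hn)
      exact h1.trans ((Nat.le_add_left M c₁).trans (Nat.le_add_left _ _))
    · have h1 : (t n : ℝ) ≤ C * Real.log n := by
        have := hn₀ n hn
        rwa [Real.norm_natCast, Real.norm_eq_abs, abs_of_nonneg (Real.log_natCast_nonneg n)] at this
      have h2 := log_lt_natLog_two_add_one_mul_log_two n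
      have h3 : C * Real.log 2 ≤ c₁ := Nat.le_ceil _
      have hk0 : (0 : ℝ) ≤ Nat.log 2 n := Nat.cast_nonneg _
      have h4 : (t n : ℝ) ≤ c₁ * Nat.log 2 n + c₁ := by
        calc (t n : ℝ) ≤ C * Real.log n := h1
          _ ≤ C * (((Nat.log 2 n : ℝ) + 1) * Real.log 2) := by gcongr
          _ = C * Real.log 2 * Nat.log 2 n + C * Real.log 2 := by ring
          _ ≤ c₁ * Nat.log 2 n + c₁ := by gcongr
      have h5 : t n ≤ c₁ * Nat.log 2 n + c₁ := by exact_mod_cast h4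
      calc t n ≤ c₁ * Nat.log 2 n + c₁ := h5
        _ ≤ (c₁ + M) * Nat.log 2 n + (c₁ + M) :=
          Nat.add_le_add (Nat.mul_le_mul_right _ (Nat.le_add_right _ _)) (Nat.le_add_right _ _)

/-- **`BQP^{A[log]}` with `O(log n)` in Mathlib's sense**: `L ∈ BQPRelLog A` iff some poly-time
uniform Clifford+T oracle-circuit family whose number of oracle gates at length `n` is
`O(log n)` (`=O[atTop] Real.log`) decides `L` relative to `A` with error `≤ 1/3` — literally
"decidable by a `BQP` machine able to make `O(log n)` queries to `A`". [cite: AaronsonAmbainis2014, §3 (paragraph before Thm. 26, arXiv v3 numbering)] -/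
theorem mem_BQPRelLog_iff_isBigO {L : Language Bool} :
    L ∈ BQPRelLog A ↔ ∃ F : QCircuitFamily cliffordT, F.IsUniform ∧
      ((fun n => ((F.circ n).oracleQueries : ℝ)) =O[atTop] fun n => Real.log (n : ℝ)) ∧
      ∀ x, (x ∈ L → 2 / 3 ≤ F.acceptProbOn A x) ∧ (x ∉ L → F.acceptProbOn A x ≤ 1 / 3) := by
  rw [mem_BQPRelLog_iff]
  constructor
  · rintro ⟨c, F, hU, hq, hL⟩
    exact ⟨F, hU, (exists_le_mul_log_add_iff_isBigO_log _).1 ⟨c, hq⟩, hL⟩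
  · rintro ⟨F, hU, hq, hL⟩
    obtain ⟨c, hc⟩ := (exists_le_mul_log_add_iff_isBigO_log _).2 hq
    exact ⟨c, F, hU, hc, hL⟩

end Literature.Computability.QuantumComplexity

end
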